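import Mathlib
import HarnessLib
import Summits.HubbardSuperconductivity.HubbardSuperconductivity.Theorems.KLProgrammeKLRegimeTwoVolumeSpineDataDefs
import Summits.HubbardSuperconductivity.HubbardSuperconductivity.Theorems.KLProgrammeKLRegimeTwoVolumeSrcSectorScaleSuccMinSP

/-!
# Route `KLProgramme` — crux K3, VL child `KLRegimeVolumeLimitV17F2` (stmt-HubbardSuperconductivity-20440), blueprint v5 M5: THE PER-SCALE STEP TAKING THE DATA
# BUNDLES, RE-ANALYSIS BLOCKS BY PERIODISATION (seat hubbard-kl-k3c4-p1 g12; `--supports` 20440)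

Verbatim twin of `…TwoVolumeSrcSectorScaleSuccBundled` (p591806) over `…MinSP`: **`srcSector_sum_norm_kernel_twoVolume_scaleSucc_bundledP_le`** — the two
re-analysis blocks related by the periodisation identity `hPT₀` instead of the sampled form (base of the tower: identity re-analysis).  No definition.
-/

noncomputable section

namespace Summit.HubbardSuperconductivity.HubbardSuperconductivity.Theorems.TwoVolumeDefect

set_option linter.dupNamespace false -- summit = problem name (single-conjunct summit), D-0017

open Finset Literature.MathematicalPhysics.QuantumLattice GrassmannAlgebra Literature.Probability.LatticeModels
  Literature.Probability.LatticeModels.BattleFederbush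
open Summit.HubbardSuperconductivity.HubbardSuperconductivity.Theorems.TwoPointAssembly

set_option maxHeartbeats 400000 in -- one 120-binder instantiation
/-- **ONE SCALE OF THE TWO-VOLUME INDUCTION, BUNDLED DATA** (MinS with the `…SpineDataDefs` structures). [folklore; BGM 2006 §2.7, §2.9, §3] -/
theorem srcSector_sum_norm_kernel_twoVolume_scaleSucc_bundledP_le {b L Lf M N N₁ : ℕ} [NeZero Lf] [NeZero L] [NeZero M]
    [LinearOrder ((SpaceTimeIdx Lf M × SectorLeg N) × Fin 2)]
    (hLf : Lf = b * L) {β : ℝ} (hβ : β ≠ 0) {Λ : ℝ} (hΛ : 0 < Λ)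
    -- the block structures of the scale-`j+1` and scale-`j` legs and their doublings
    (e : (SpaceTimeIdx Lf M × SectorLeg N) ≃ (Fin 2 → Fin b) × (SpaceTimeIdx L M × SectorLeg N))
    (he1 : ∀ X' i, ((e X').1 i : ℕ) = (X'.1.2 i).val / L) (he2 : ∀ X', (e X').2 = ((X'.1.1, fun i => (((X'.1.2 i).val : ℕ) : ZMod L)), X'.2))
    (ed : ((SpaceTimeIdx Lf M × SectorLeg N) × Fin 2) ≃ (Fin 2 → Fin b) × ((SpaceTimeIdx L M × SectorLeg N) × Fin 2)) (hed : ∀ x s, ed (x, s) = ((e x).1, ((e x).2, s)))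
    (e₁ : (SpaceTimeIdx Lf M × SectorLeg N₁) ≃ (Fin 2 → Fin b) × (SpaceTimeIdx L M × SectorLeg N₁))
    (he₁1 : ∀ X' i, ((e₁ X').1 i : ℕ) = (X'.1.2 i).val / L) (he₁2 : ∀ X', (e₁ X').2 = ((X'.1.1, fun i => (((X'.1.2 i).val : ℕ) : ZMod L)), X'.2))
    (ed₁ : ((SpaceTimeIdx Lf M × SectorLeg N₁) × Fin 2) ≃ (Fin 2 → Fin b) × ((SpaceTimeIdx L M × SectorLeg N₁) × Fin 2)) (hed₁ : ∀ x s, ed₁ (x, s) = ((e₁ x).1, ((e₁ x).2, s)))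
    -- the sampled fat family and symbol of the STEP covariances, the spectator lifts
    (𝔣t : Fin N → MatsubaraIdx M → (Fin 2 → ℝ) → ℂ) (Φ : MatsubaraIdx M → Fin 2 → (Fin 2 → ℝ) → ℂ)
    (FtL : Fin N → FreqMomentum L M → ℂ) (FtLf : Fin N → FreqMomentum Lf M → ℂ)
    (hFtL : ∀ ω i q, FtL ω (i, q) = 𝔣t ω i (latticeMomentum L q)) (hFtLf : ∀ ω i q, FtLf ω (i, q) = 𝔣t ω i (latticeMomentum Lf q))
    (pL : FreqMomentum L M × Fin 2 → ℂ) (pLf : FreqMomentum Lf M × Fin 2 → ℂ)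
    (hpL : ∀ i q σ, pL ((i, q), σ) = ((β * (L : ℝ) ^ 2 : ℝ) : ℂ) * Φ i σ (latticeMomentum L q))
    (hpLf : ∀ i q σ, pLf ((i, q), σ) = ((β * (Lf : ℝ) ^ 2 : ℝ) : ℂ) * Φ i σ (latticeMomentum Lf q))
    (CL : Matrix (SpaceTimeIdx L M × SectorLeg N) (SpaceTimeIdx L M × SectorLeg N) ℂ)
    (hCL : CL = (sectorSubMatrix L M β FtL).transpose * normalCovariance L M pL * sectorSubMatrix L M β FtL)
    (CLf : Matrix (SpaceTimeIdx Lf M × SectorLeg N) (SpaceTimeIdx Lf M × SectorLeg N) ℂ)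
    (hCLf : CLf = (sectorSubMatrix Lf M β FtLf).transpose * normalCovariance Lf M pLf * sectorSubMatrix Lf M β FtLf)
    (Cd : Matrix ((SpaceTimeIdx L M × SectorLeg N) × Fin 2) ((SpaceTimeIdx L M × SectorLeg N) × Fin 2) ℂ) (hCd : ∀ p q, Cd p q = if p.2 = 0 ∧ q.2 = 0 then CL p.1 q.1 else 0)
    (Cd' : Matrix ((SpaceTimeIdx Lf M × SectorLeg N) × Fin 2) ((SpaceTimeIdx Lf M × SectorLeg N) × Fin 2) ℂ) (hCd' : ∀ p q, Cd' p q = if p.2 = 0 ∧ q.2 = 0 then CLf p.1 q.1 else 0)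
    -- the re-analysis blocks `T_V` related by periodisation, the source relabellings `J_V`, the block substitutions `T⁺_V`
    (Tc : Matrix (SpaceTimeIdx L M × SectorLeg N) (SpaceTimeIdx L M × SectorLeg N₁) ℂ)
    (Tf : Matrix (SpaceTimeIdx Lf M × SectorLeg N) (SpaceTimeIdx Lf M × SectorLeg N₁) ℂ)
    (hPT₀ : ∀ (X' : (SpaceTimeIdx Lf M × SectorLeg N)) (Y : (SpaceTimeIdx L M × SectorLeg N₁)),
      ∑ Y'' ∈ univ.filter (fun Y'' : (SpaceTimeIdx Lf M × SectorLeg N₁) => (e₁ Y'').2 = Y), Tf X' Y'' = Tc (e X').2 Y)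
    (Jc : Matrix (SpaceTimeIdx L M × SectorLeg N) (SpaceTimeIdx L M × SectorLeg N₁) ℂ) (Jf : Matrix (SpaceTimeIdx Lf M × SectorLeg N) (SpaceTimeIdx Lf M × SectorLeg N₁) ℂ)
    (hPJ : ∀ (X' : (SpaceTimeIdx Lf M × SectorLeg N)) (Y : (SpaceTimeIdx L M × SectorLeg N₁)),
      ∑ Y'' ∈ univ.filter (fun Y'' : (SpaceTimeIdx Lf M × SectorLeg N₁) => (e₁ Y'').2 = Y), Jf X' Y'' = Jc (e X').2 Y)
    (Tpc : Matrix ((SpaceTimeIdx L M × SectorLeg N) × Fin 2) ((SpaceTimeIdx L M × SectorLeg N₁) × Fin 2) ℂ)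
    (hTpc : ∀ p' p, Tpc p' p = if p'.2 = 0 ∧ p.2 = 0 then Tc p'.1 p.1 else if p'.2 = 1 ∧ p.2 = 1 then Jc p'.1 p.1 else 0)
    (Tpf : Matrix ((SpaceTimeIdx Lf M × SectorLeg N) × Fin 2) ((SpaceTimeIdx Lf M × SectorLeg N₁) × Fin 2) ℂ)
    (hTpf : ∀ p' p, Tpf p' p = if p'.2 = 0 ∧ p.2 = 0 then Tf p'.1 p.1 else if p'.2 = 1 ∧ p.2 = 1 then Jf p'.1 p.1 else 0)
    -- the region schedule: zone depth `R`, extra pin depth `R′`, transfer radii `RN ≤ RZ`, `RF`, tail radius `r` (`r ≤ RN`, `r ≤ RF`, `r + RZ ≤ R`); the pin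
    (R R' RN RZ RF r : ℕ) (hNZ : RN ≤ RZ) (hrN : r ≤ RN) (hrF : r ≤ RF) (hrZR : r + RZ ≤ R)
    (w : ((SpaceTimeIdx Lf M × SectorLeg N) × Fin 2)) (hw : ∀ j, R + R' ≤ (w.1.1.2 j).val % L ∧ (w.1.1.2 j).val % L + (R + R') < L)
    -- ONE-VOLUME COVARIANCE DATA (bundled), both volumes; the fine sectional row
    {κ κ' αW αW' sW sW' eW' : ℝ} (hC : ScaleCovData CL Λ κ αW sW) (hC' : ScaleCovData CLf Λ κ' αW' sW') (hCsec : ScaleCovSecData CLf Λ eW')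
    -- ONE-VOLUME TRANSFER DATA of `T⁺_{L″}` (bundled)
    {ΛT cW : ℝ} (hTr : TransferWtData Tpf ed ed₁ ΛT cW)
    -- the two DOUBLED scale-`j` actions (parity, no constant part) and their ONE-VOLUME profiles: the coarse previous action at its own rate `Λ₁` (raw degree),
    -- the two re-analysed inputs at rate `Λ` (the engine's sub-diagonal read-outs), the coarse step's field radius `ρ₀` and its smallness
    (𝒲 : GrassmannAlgebra ℂ ((SpaceTimeIdx L M × SectorLeg N₁) × Fin 2)) (h𝒲e : 𝒲 ∈ evenOdd ℂ 0) (h𝒲0 : constPart ℂ 𝒲 = 0)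
    (𝒲' : GrassmannAlgebra ℂ ((SpaceTimeIdx Lf M × SectorLeg N₁) × Fin 2)) (h𝒲'e : 𝒲' ∈ evenOdd ℂ 0) (h𝒲'0 : constPart ℂ 𝒲' = 0)
    {Λ₁ : ℝ} (hΛ₁ : 0 ≤ Λ₁) (N𝒲 NV NW' : ℕ → ℝ) (hN𝒲 : WtProfileRaw 𝒲 Λ₁ N𝒲)
    (hNV : WtProfileEven (ExteriorAlgebra.map (Matrix.toLin' Tpc) 𝒲) Λ NV) (hNW' : WtProfileEven (ExteriorAlgebra.map (Matrix.toLin' Tpf) 𝒲') Λ NW')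
    {ρ₀ : ℝ} (hρ₀ : 0 < ρ₀) (hθ₀ : Real.exp 1 * αW * normV ((SpaceTimeIdx L M × SectorLeg N) × Fin 2) κ ρ₀ NV / κ ^ 2 < 1)
    (Nw : ℕ → ℝ) (hNwdef : ∀ m', Nw m' = ρ₀⁻¹ ^ (2 * m') * (Real.exp 1 * normV ((SpaceTimeIdx L M × SectorLeg N) × Fin 2) κ ρ₀ NV) / (1 - Real.exp 1 * αW * normV ((SpaceTimeIdx L M × SectorLeg N) × Fin 2) κ ρ₀ NV / κ ^ 2))
    -- the other field radii and the smallness conditions of the two-volume step (α = m₁ = s := αW, primed := αW′)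
    {ρf : ℝ} (hρf : 0 < ρf)
    (hθw : Real.exp 1 * (αW' + αW + (αW' + αW)) * normV ((SpaceTimeIdx Lf M × SectorLeg N) × Fin 2) (κ' + κ) ρf Nw / (κ' + κ) ^ 2 < 1)
    {ρ₂ : ℝ} (hρ₂ : 0 < ρ₂)
    (hθ₂ : Real.exp 1 * (αW' + αW + (αW' + αW)) * normV ((SpaceTimeIdx Lf M × SectorLeg N) × Fin 2) (κ' + κ + (κ' + κ + (κ' + κ))) ρ₂ Nw /
      (κ' + κ + (κ' + κ + (κ' + κ))) ^ 2 < 1)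
    -- the scale-`j` TWO-VOLUME data (induction hypothesis) in block-reduced form, the transfer majorant `Ein` with `aT := cW`, `τT := cW/(1+Λ_T(r+1))`,
    -- `Nj := N𝒲`, `Nfarj := N𝒲/(1+Λ₁(RZ−RN+1))`, its cap, and the two smallness conditions of the interaction bracket
    (Ej NDj : ℕ → ℝ) (hD : KeyedDefectData (N := N) ed₁ 𝒲' 𝒲 R RF Ej NDj)
    (Ein : ℕ → ℝ) (hEin0 : ∀ m', 0 ≤ Ein m')
    (hEin : ∀ m', 1 ≤ m' → ∀ n : ℕ, 2 * m' = n + 1 →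
      cW ^ n * (cW * Ej (n + 1) + cW / (1 + ΛT * ((r : ℝ) + 1)) * NDj (n + 1)) +
        (2 * cW ^ n * (cW / (1 + ΛT * ((r : ℝ) + 1))) * N𝒲 (n + 1) +
          n * cW ^ n * (5 * (cW / (1 + ΛT * ((r : ℝ) + 1))) * N𝒲 (n + 1) + 2 * cW * ((1 + Λ₁ * (((RZ - RN : ℕ) : ℝ) + 1))⁻¹ * N𝒲 (n + 1)))) ≤ Ein m')
    {ρ' : ℝ} (hρ' : 0 < ρ') {νEbar : ℝ} (hνE : normV ((SpaceTimeIdx Lf M × SectorLeg N) × Fin 2) κ' ρ' Ein ≤ νEbar)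
    (hbar : Real.exp 1 * αW' * (normV ((SpaceTimeIdx Lf M × SectorLeg N) × Fin 2) κ' ρ' (fun m' => NV m' + (NW' m' + NV m')) + νEbar) / κ' ^ 2 < 1)
    (hθ₂' : Real.exp 1 * αW' * (normV ((SpaceTimeIdx Lf M × SectorLeg N) × Fin 2) κ' ρ' NV + normV ((SpaceTimeIdx Lf M × SectorLeg N) × Fin 2) κ' ρ' (fun m' => NW' m' + NV m')) / κ' ^ 2 < 1)
    (n : ℕ) (p : Fin (n + 1)) :
    ∑ X ∈ univ.filter (fun X : Fin (n + 1) → ((SpaceTimeIdx Lf M × SectorLeg N) × Fin 2) => X p = w),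
        ‖kernel ℂ (effAction ℂ Cd' (ExteriorAlgebra.map (Matrix.toLin' Tpf) 𝒲')) (n + 1) X -
          (if ∀ i, (ed (X i)).1 = (ed (X p)).1 then
            kernel ℂ (effAction ℂ Cd (ExteriorAlgebra.map (Matrix.toLin' Tpc) 𝒲)) (n + 1) (fun i => (ed (X i)).2) else 0)‖ ≤
      (ρ'⁻¹ ^ (n + 1) * Real.exp 1 / (1 - Real.exp 1 * αW' * (normV ((SpaceTimeIdx Lf M × SectorLeg N) × Fin 2) κ' ρ' (fun m' => NV m' + (NW' m' + NV m')) + νEbar) / κ' ^ 2) ^ 2) * normV ((SpaceTimeIdx Lf M × SectorLeg N) × Fin 2) κ' ρ' Ein +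
        (ρ'⁻¹ ^ (n + 1) * (Real.exp 1 * normV ((SpaceTimeIdx Lf M × SectorLeg N) × Fin 2) κ' ρ' (fun m' => NW' m' + NV m')) / (1 - Real.exp 1 * αW' * (normV ((SpaceTimeIdx Lf M × SectorLeg N) × Fin 2) κ' ρ' NV + normV ((SpaceTimeIdx Lf M × SectorLeg N) × Fin 2) κ' ρ' (fun m' => NW' m' + NV m')) / κ' ^ 2) ^ 2) * (1 + Λ * ((R' : ℝ) + 1))⁻¹ +
        ((((n + 1 + 1) * (n + 1 + 2) : ℕ) : ℝ) / 2 *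
            (ρ₂⁻¹ ^ (n + 3) * (Real.exp 1 * normV ((SpaceTimeIdx Lf M × SectorLeg N) × Fin 2) (κ' + κ + (κ' + κ + (κ' + κ))) ρ₂ Nw) / (1 - Real.exp 1 * (αW' + αW + (αW' + αW)) * normV ((SpaceTimeIdx Lf M × SectorLeg N) × Fin 2) (κ' + κ + (κ' + κ + (κ' + κ))) ρ₂ Nw / (κ' + κ + (κ' + κ + (κ' + κ))) ^ 2))) * (eW' / (1 + Λ * ((R : ℝ) + 1))) +
        (‖(2 : ℂ)⁻¹‖ * ∑ a ∈ range (n + 2), ∑ b ∈ range (n + 2),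
            (if a + b = n + 1 then (((a + 1) * (b + 1) : ℕ) : ℝ) *
              (4 * (ρ₂⁻¹ ^ (a + 1) * (Real.exp 1 * normV ((SpaceTimeIdx Lf M × SectorLeg N) × Fin 2) (κ' + κ + (κ' + κ + (κ' + κ))) ρ₂ Nw) / (1 - Real.exp 1 * (αW' + αW + (αW' + αW)) * normV ((SpaceTimeIdx Lf M × SectorLeg N) × Fin 2) (κ' + κ + (κ' + κ + (κ' + κ))) ρ₂ Nw / (κ' + κ + (κ' + κ + (κ' + κ))) ^ 2)) *
                (ρ₂⁻¹ ^ (b + 1) * (Real.exp 1 * normV ((SpaceTimeIdx Lf M × SectorLeg N) × Fin 2) (κ' + κ + (κ' + κ + (κ' + κ))) ρ₂ Nw) / (1 - Real.exp 1 * (αW' + αW + (αW' + αW)) * normV ((SpaceTimeIdx Lf M × SectorLeg N) × Fin 2) (κ' + κ + (κ' + κ + (κ' + κ))) ρ₂ Nw / (κ' + κ + (κ' + κ + (κ' + κ))) ^ 2))) else 0)) * (αW' / (1 + Λ * ((R : ℝ) + 1))) +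
        ((((n + 1 + 1) * (n + 1 + 2) : ℕ) : ℝ) / 2 * (sW' + sW) *
              (ρf⁻¹ ^ (n + 3) * (Real.exp 1 * normV ((SpaceTimeIdx Lf M × SectorLeg N) × Fin 2) (κ' + κ) ρf Nw) / (1 - Real.exp 1 * (αW' + αW + (αW' + αW)) * normV ((SpaceTimeIdx Lf M × SectorLeg N) × Fin 2) (κ' + κ) ρf Nw / (κ' + κ) ^ 2)) +
            ‖(2 : ℂ)⁻¹‖ * ∑ a ∈ range (n + 2), ∑ b ∈ range (n + 2),
              (if a + b = n + 1 then (((a + 1) * (b + 1) : ℕ) : ℝ) *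
                (2 * (αW' + αW) * (ρf⁻¹ ^ (a + 1) * (Real.exp 1 * normV ((SpaceTimeIdx Lf M × SectorLeg N) × Fin 2) (κ' + κ) ρf Nw) / (1 - Real.exp 1 * (αW' + αW + (αW' + αW)) * normV ((SpaceTimeIdx Lf M × SectorLeg N) × Fin 2) (κ' + κ) ρf Nw / (κ' + κ) ^ 2)) *
                  (ρf⁻¹ ^ (b + 1) * (Real.exp 1 * normV ((SpaceTimeIdx Lf M × SectorLeg N) × Fin 2) (κ' + κ) ρf Nw) / (1 - Real.exp 1 * (αW' + αW + (αW' + αW)) * normV ((SpaceTimeIdx Lf M × SectorLeg N) × Fin 2) (κ' + κ) ρf Nw / (κ' + κ) ^ 2))) else 0)) * (Λ * ((R' : ℝ) + 1))⁻¹ :=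
  srcSector_sum_norm_kernel_twoVolume_scaleSucc_minSP_le hLf hβ hΛ e he1 he2 ed hed e₁ he₁1 he₁2 ed₁ hed₁ 𝔣t Φ FtL FtLf hFtL hFtLf pL pLf hpL hpLf CL hCL CLf hCLf
    Cd hCd Cd' hCd' Tc Tf hPT₀ Jc Jf hPJ Tpc hTpc Tpf hTpf R R' RN RZ RF r hNZ hrN hrF hrZR w hw
    hC.κ_pos hC'.κ_pos hC.gram hC'.gram hC.αW_pos hC'.αW_pos hC.row hC.col hC'.row hC'.col hC.sW_nonneg hC'.sW_nonneg hC.entry hC'.entry hCsec.sec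
    hTr.ΛT_nonneg hTr.cW_nonneg hTr.row hTr.col hTr.cov 𝒲 h𝒲e h𝒲0 𝒲' h𝒲'e h𝒲'0 hΛ₁ N𝒲 hN𝒲.nonneg hN𝒲.le NV NW' hNV.nonneg hNW'.nonneg hNV.le hNW'.le
    hρ₀ hθ₀ Nw hNwdef hρf hθw hρ₂ hθ₂ Ej NDj hD.Ej_nonneg hD.NDj_nonneg hD.deep hD.everywhere Ein hEin0 hEin hρ' hνE hbar hθ₂' n p

end Summit.HubbardSuperconductivity.HubbardSuperconductivity.Theorems.TwoVolumeDefect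

end
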